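import Summits.QuantumFields.YangMills.Theorems.BalabanUVNodesN18KingModelU3Rung
import Literature.MathematicalPhysics.QuantumFieldTheory.Balaban1983to89.B10Eq25WalkGeometryTorus

/-!
# BalabanUVNodes ∕ N18 — THE KING-MODEL TRANSFER WITH ITS DECAY: King's (4.42) three-factor graphs read on the END's own
# carriers `torusCarriers N W` ∕ `reFunctional N W` (`TwoRunTorusNE5Final8`) through CONNECTING POLYMERS, so that King's
# `e^{−κ·|B(x) − B(y)|_{T₁}}` becomes `e^{−κρ·d_j(X)}` in Bałaban's tree length: `NE5` at the END's carriers with `κ′ = κρ > 0`,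
# `θ = L^{−γ∕2}`, `C₅(d, L, a, m², γ)`; and the torus geometry making it non-vacuous (Track A, DAG node N18 = NE5
# `T4OutputRate.NE5 EA EB W κ θ C₅` :211; director-ym R134 row n18 s3 «King-model transfer `N18KingModelTorus` (κ, C₅ from
# (d, L, a, m², γ)) → `TwoRunTorusNE5Final*`», the `κ` half)

HONEST FRAMING.  Count-neutral kernel bookkeeping (seat pub-ymgap-dag-n18-e g2, strategy s3; `--supports
stmt-QuantumFields-19676` = K3 `SpineGivenEndpointR11`).  King's `A = 0` scalar MODEL ([King1986], printed and proved, typed by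
seats n18-a∕n18-b) — NOT Bałaban's covariant one-step outputs `E^{(j)}(X; g, U_k(V))` of [Balaban1987RG1] (0.24)∕(2.13), for
which NE5 is NOT IN PRINT and has no tree producer (NODE O instance 0∕1); NOT a node discharge; finite tori; nothing
continuum ∕ ℝ⁴ ∕ OS ∕ mass-gap ∕ Clay.  THEOREMS ONLY: 0 `def`, 0 `sorry`, standard axioms.

THE POINT.  `N18KingModelU3Rung` (p450669) §3 placed King's model on the END's carriers with `θ` and `C₅` transferred but the
decay exponent `κ′ = 0`, and LOCATED why: a reading that hands ONE pair of points to EVERY domain `X ∈ 𝐃_j` carries no decay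
in `d_j(X)` (the whole torus is a domain).  That is a property of the reading, not of King's graphs.  Read instead as
Bałaban reads a line of a graph ([Balaban1985UV3] p. 262: *"A line of the graph connecting vertices □_i, □_j is replaced by a
random walk ω … The localizations {□_j} and the walks ω … define a localization X"*): a domain is LIVE when it is a
connecting polymer of the pair it carries — `ρ·d_j(X) ≤ |B(x_A) − B(y_A)|_{T₁}` — and dead domains read the same value in both
runs.  Then King's (3.73) first bound for the ACTUAL (4.42) graphs (`N18KingModelTorus.ne5_kingModel_threeFactor_torus`,
p418046: `κ > 0`, decay in the block distance) IS the END's `NE5` with exponent `κρ`: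
* §1 TORUS GEOMETRY (d, N general; folklore, PROVED): `tFaceConnected_segment` (the cubes `z + t·e_μ`, `t ≤ k`, are a
  connected family), `exists_steps_of_circAbs` (`dist(a − b, Nℤ)` is a number of unit steps from `a` to `b` or back),
  `exists_torusStaircase` ∕ `exists_connecting_polymer` (two cubes `p, q` lie in a connected family `X` with
  `|X| − 1 ≤ Σ_μ dist(p_μ − q_μ, Nℤ) ≤ d·tdistT p q`: one segment per coordinate, glued by
  `B10Eq25WalkGeometryTorus.tFaceConnected_union`), **`exists_connecting_tdom`**: `∃ X ∈ 𝐃_j ∋ p, q`, `d_j(X) ≤ d·|p − q|_{T₁}`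
  ((2.30) upper half `TreeLengthTorus.torusTreeLen_le_card_sub_one`, `King1986.Torus.circAbs_le_tdistT`).
* §2 **`ne5_kingModel_endCarriers_decay`** — `∃ κ > 0, C₅ ≥ 0` (those of p418046) such that for every `n ≥ 1`, unit tori
  `L·M_k(μ) = 2L^{m_k}`, END data `N, W`, LIVE set `S ⊆ Σ_j 𝐃_j`, ratio `ρ ≥ 0`, pair-reading `x_A, y_A` (King level `j + 1`;
  King's levels start at 1, (2.13)) under `x_B, y_B` with `ρ·d_j(X) ≤ |B(x_A X) − B(y_A X)|_{T₁}` on `S`, and real families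
  `K_A, K_B` equal to King's (4.42) graphs of the two runs on `S` and to EACH OTHER off `S`:
  `NE5 (torusCarriers N W) (reFunctional … K_A) (reFunctional … K_B) W′ (κρ) (L^{−γ∕2}) C₅`.  Composition: p418046 on the
  auxiliary carriers `⟨Σ_j 𝐃_j, j + 1, min(ρ·d_j(X), |B(x_A) − B(y_A)|_{T₁}), PUnit, PUnit, 0, id⟩` (the `min` meets p418046's
  tree-length binder at every domain without deciding liveness), `θ^{j+1} ≤ θ^j`, `min = ρ·d_j` on `S`, `K_A = K_B` off `S`,
  then `N18KingModelU3Rung.ne5_reFunctional_of_real` (p450669).  `endCarriers_decay_letters`: `κρ > 0`, `0 < L^{−γ∕2} < 1`.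
  (`N18At` on the END's bundle shape follows by `N18AtByName.n18At_of_ne5`, as in p450669 §3 — not restated.)
* §3 NON-VACUITY: `exists_live_domain` (d = 4; the END's `𝐃_j` drawn on King's unit torus, `TPt 4 (L·M) = Tor (fine L M)`
  definitionally): EVERY pair of blocks `p, q` lies in a domain `X ∈ 𝐃_j ∋ p, q` with `(1∕4)·d_j(X) ≤ |p − q|_{T₁}` — so §2's
  binders are jointly met NON-IDLY at any prescribed King carrier `(j, x′, y′)`: `S = {⟨j, X⟩}`, the reading hands the pair
  to `X` (`x_μ = ⌊x′_μ∕L^n⌋`: `coarse_val`, as in p418046 §3), `K_A, K_B` = the two graphs at `⟨j, X⟩` and `0` elsewhere,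
  `ρ = 1∕4`, exponent `κ∕4 > 0`.
WHAT THIS DOES NOT DO.  One pair per live domain (Bałaban's `E^{(j)}(X)` sums all lines localized in `X` with combinatorial
factors — [Balaban1985UV3] (23)–(25), NODE A ∕ N10 content); `A = 0`, `g`∕`U` unread (`a = b = 0` in `u3_geometric`, as in
p450669); `j = 0` piece, (2.20)-rescaling, derivative ∕ Hölder lines outside (n18-a's `…TorusDeriv` ∕ `…TorusHolder*`).

Sources: C. King, Commun. Math. Phys. **102** (1986) 649–677 [King1986] — Prop. 3.9 (3.73) p. 665 (*"exp[−δ₀(L^jη)^{−1}|x −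
y|]"*), (4.42)–(4.43) p. 675; T. Bałaban, Commun. Math. Phys. **109** (1987) 249–301 [Balaban1987RG1] — p. 257 (localization
domains, connected families, linear size `d_j(X)`), (0.24)–(0.25) p. 257, Thm 1 p. 259; **116** (1988) 1–22
[Balaban1988RG2Cluster] (2.30) p. 18; **102** (1985) 255–275 [Balaban1985UV3] p. 262.  No claim about the Yang–Mills mass gap.
-/


noncomputable section

namespace Summit.QuantumFields.YangMills.BalabanUVNodes.N18KingModelEndDecay

open Matrix
open Literature.MathematicalPhysics.QuantumFieldTheory.Balaban1983to89
open Literature.MathematicalPhysics.QuantumFieldTheory.Balaban1983to89.T4OutputRate (Carriers NE5)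
open Literature.MathematicalPhysics.QuantumFieldTheory.Balaban1983to89.B5Prop11Plancherel (Tor fine)
open Literature.MathematicalPhysics.QuantumFieldTheory.Balaban1983to89.TreeLengthTorus
  (TPt TAdj tadj_update_add_one TLinked TFaceConnected TDom torusTreeLen torusTreeLen_nonneg
    torusTreeLen_le_card_sub_one tsys)
open Literature.MathematicalPhysics.QuantumFieldTheory.Balaban1983to89.TreeLengthTorusTransfer
  (tLinked_symm tLinked_trans)
open Literature.MathematicalPhysics.QuantumFieldTheory.Balaban1983to89.B10Eq25WalkGeometryTorus (tFaceConnected_union)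
open Literature.MathematicalPhysics.QuantumFieldTheory.Balaban1983to89.B4TorusKernel.MultiPeriod (circAbs)
open Literature.MathematicalPhysics.QuantumFieldTheory.Balaban1983to89.B13Lemma3Torus (TwoTorusStep)
open Literature.MathematicalPhysics.QuantumFieldTheory.King1986 (aK)
open Literature.MathematicalPhysics.QuantumFieldTheory.King1986.Torus
  (minimiser effLaplacian blockProj blockOf tdistT tdistT_nonneg circAbs_le_tdistT)
open Summit.QuantumFields.BalabanUV.T4Continuum.Spine.NE5.TwoRunTorusNE5 (torusCarriers reFunctional)
open Summit.QuantumFields.YangMills.BalabanUVNodes.N18KingModel (kingTheta_pos kingTheta_le_one)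
open Summit.QuantumFields.YangMills.BalabanUVNodes.N18KingModelTorus
  (ne5_kingModel_threeFactor_torus ne5_kingModel_threeFactor_letters)
open Summit.QuantumFields.YangMills.BalabanUVNodes.N18KingModelU3Rung (ne5_reFunctional_of_real)

/-! ## §1 Torus geometry: segments, staircases, connecting polymers (d, N general) -/

section Geometry

variable {d N : ℕ}

/-- The cube `z + t·e_μ` (`t ≤ k`) belongs to the segment `{z + s·e_μ : s ≤ k}` of the torus `(ℤ∕N)^d`. [folklore] -/
theorem update_mem_segment (z : TPt d N) (μ : Fin d) {k t : ℕ} (ht : t ≤ k) :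
    Function.update z μ (z μ + t) ∈
      (Finset.range (k + 1)).image fun s : ℕ => Function.update z μ (z μ + (s : ZMod N)) :=
  Finset.mem_image.2 ⟨t, Finset.mem_range.2 (Nat.lt_succ_of_le ht), rfl⟩

/-- **A straight segment of cubes is a connected family of the torus**: the cubes `z + s·e_μ`, `s = 0, …, k`, of `(ℤ∕N)^d`
form a torus-face-connected family (consecutive cubes have a common wall, `TreeLengthTorus.tadj_update_add_one`; chains
reverse and concatenate, `TreeLengthTorusTransfer.tLinked_symm` ∕ `tLinked_trans`). [cite: Balaban1987RG1, p.257 (connected families of cubes)] -/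
theorem tFaceConnected_segment (z : TPt d N) (μ : Fin d) (k : ℕ) :
    TFaceConnected ((Finset.range (k + 1)).image fun s : ℕ => Function.update z μ (z μ + (s : ZMod N))) := by
  set S := (Finset.range (k + 1)).image fun s : ℕ => Function.update z μ (z μ + (s : ZMod N)) with hS
  -- every cube of the segment is chained to its foot `z` inside the segment
  have hchain : ∀ t : ℕ, t ≤ k → TLinked S z (Function.update z μ (z μ + (t : ZMod N))) := by
    intro t
    induction t with
    | zero =>
      intro _
      rw [Nat.cast_zero, add_zero, Function.update_eq_self]
      exact Relation.ReflTransGen.refl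
    | succ t ih =>
      intro ht
      have ht' : t ≤ k := Nat.le_of_succ_le ht
      refine Relation.ReflTransGen.tail (ih ht') ⟨update_mem_segment z μ ht', update_mem_segment z μ ht, ?_⟩
      have h1 := tadj_update_add_one (Function.update z μ (z μ + (t : ZMod N))) μ
      rw [Function.update_self, Function.update_idem] at h1
      rwa [Nat.cast_succ, ← add_assoc]
  intro x hx y hy
  obtain ⟨s, hs, rfl⟩ := Finset.mem_image.1 hx
  obtain ⟨t, ht, rfl⟩ := Finset.mem_image.1 hy
  exact tLinked_trans (tLinked_symm (hchain s (Nat.le_of_lt_succ (Finset.mem_range.1 hs))))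
    (hchain t (Nat.le_of_lt_succ (Finset.mem_range.1 ht)))

variable [NeZero N]

/-- **The circular coordinate distance is a number of unit steps.**  In `ℤ∕N` (`N ≥ 1`) the distance
`dist(a − b, Nℤ) = circAbs N (a.val − b.val)` (`B4TorusKernel.MultiPeriod.circAbs`, values in `[0, N∕2]`) is realised by a
natural number `k` of `+1`-steps, from `b` to `a` (`a = b + k`) or from `a` to `b` (`b = a + k`). [folklore] -/
theorem exists_steps_of_circAbs (a b : ZMod N) :
    ∃ k : ℕ, (k : ℤ) = circAbs N ((a.val : ℤ) - (b.val : ℤ)) ∧ (a = b + (k : ZMod N) ∨ b = a + (k : ZMod N)) := by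
  have hN : 1 ≤ N := Nat.one_le_iff_ne_zero.mpr (NeZero.ne N)
  have hab : (((a.val : ℤ) - (b.val : ℤ) : ℤ) : ZMod N) = a - b := by
    push_cast [ZMod.natCast_zmod_val]; rfl
  set z : ℤ := (a.val : ℤ) - (b.val : ℤ) with hz
  have h0 : 0 ≤ z % (N : ℤ) := Int.emod_nonneg _ (by exact_mod_cast (show N ≠ 0 from NeZero.ne N))
  have h1 : z % (N : ℤ) < N := Int.emod_lt_of_pos _ (by exact_mod_cast hN)
  by_cases hle : z % (N : ℤ) ≤ (N : ℤ) - z % (N : ℤ)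
  · refine ⟨(z % (N : ℤ)).toNat, ?_, Or.inl ?_⟩
    · rw [Int.toNat_of_nonneg h0, circAbs, min_eq_left hle]
    · have : ((((z % (N : ℤ)).toNat : ℕ) : ℤ) : ZMod N) = a - b := by
        rw [Int.toNat_of_nonneg h0, ZMod.intCast_mod, hab]
      rw [Int.cast_natCast] at this
      rw [this]; ring
  · replace hle := not_le.mp hle
    have h2 : 0 ≤ (N : ℤ) - z % (N : ℤ) := by omega
    refine ⟨((N : ℤ) - z % (N : ℤ)).toNat, ?_, Or.inr ?_⟩
    · rw [Int.toNat_of_nonneg h2, circAbs, min_eq_right hle.le]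
    · have : (((((N : ℤ) - z % (N : ℤ)).toNat : ℕ) : ℤ) : ZMod N) = b - a := by
        rw [Int.toNat_of_nonneg h2, Int.cast_sub, ZMod.intCast_mod, hab, Int.cast_natCast, ZMod.natCast_self]
        ring
      rw [Int.cast_natCast] at this
      rw [this]; ring

/-- **The staircase.**  Two cubes `x, y` of the torus `(ℤ∕N)^d` that agree off a set `s` of coordinates lie in a
torus-face-connected family `X` with `|X| − 1 ≤ Σ_{μ ∈ s} dist(x_μ − y_μ, Nℤ)`: one segment per coordinate of `s`
(`exists_steps_of_circAbs`, `tFaceConnected_segment`), glued along the corner cubes by the union lemma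
`B10Eq25WalkGeometryTorus.tFaceConnected_union`; induction on `s`. [cite: Balaban1987RG1, p.257 (connected families of cubes)] -/
theorem exists_torusStaircase (s : Finset (Fin d)) :
    ∀ x y : TPt d N, (∀ μ, μ ∉ s → x μ = y μ) →
      ∃ X : Finset (TPt d N), x ∈ X ∧ y ∈ X ∧ TFaceConnected X ∧
        ((X.card : ℤ) - 1 ≤ ∑ μ ∈ s, circAbs N (((x μ).val : ℤ) - ((y μ).val : ℤ))) := by
  classical
  induction s using Finset.induction_on with
  | empty =>
    intro x y hxy
    have hxy' : x = y := funext fun μ => hxy μ (Finset.notMem_empty μ)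
    subst hxy'
    refine ⟨{x}, Finset.mem_singleton_self x, Finset.mem_singleton_self x, ?_, by simp⟩
    intro a ha b hb
    rw [Finset.mem_singleton] at ha hb
    subst ha; subst hb
    exact Relation.ReflTransGen.refl
  | @insert μ s hμ ih =>
    intro x y hxy
    -- first move the `μ`-th coordinate of `x` to that of `y` (the corner cube `x'`), then recurse on `s`
    set x' : TPt d N := Function.update x μ (y μ) with hx'
    have hx'y : ∀ ν, ν ∉ s → x' ν = y ν := by
      intro ν hν
      by_cases hνμ : ν = μ
      · subst hνμ; simp [hx']
      · rw [hx', Function.update_of_ne hνμ]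
        exact hxy ν (by simp [hνμ, hν])
    obtain ⟨X', hx'X, hyX, hcX, hcard⟩ := ih x' y hx'y
    have hsum : ∑ ν ∈ s, circAbs N (((x' ν).val : ℤ) - ((y ν).val : ℤ))
        = ∑ ν ∈ s, circAbs N (((x ν).val : ℤ) - ((y ν).val : ℤ)) := by
      refine Finset.sum_congr rfl fun ν hν => ?_
      have hνμ : ν ≠ μ := fun h => hμ (h ▸ hν)
      rw [hx', Function.update_of_ne hνμ]
    rw [hsum] at hcard
    obtain ⟨k, hk, hdir⟩ := exists_steps_of_circAbs (x μ) (y μ)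
    -- the segment joining `x` and the corner `x'` along `μ`: foot `x'` if `x μ = y μ + k`, foot `x` if `y μ = x μ + k`
    have hseg : ∃ T : Finset (TPt d N), x ∈ T ∧ x' ∈ T ∧ TFaceConnected T ∧ T.card ≤ k + 1 := by
      rcases hdir with h | h
      · refine ⟨(Finset.range (k + 1)).image fun s : ℕ => Function.update x' μ (x' μ + (s : ZMod N)), ?_,
          ?_, tFaceConnected_segment x' μ k, Finset.card_image_le.trans (by simp)⟩
        · have hx : x = Function.update x' μ (x' μ + (k : ZMod N)) := by
            rw [hx', Function.update_idem, Function.update_self, ← h, Function.update_eq_self]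
          rw [hx]
          exact update_mem_segment x' μ le_rfl
        · have := update_mem_segment x' μ (Nat.zero_le k)
          rwa [Nat.cast_zero, add_zero, Function.update_eq_self] at this
      · refine ⟨(Finset.range (k + 1)).image fun s : ℕ => Function.update x μ (x μ + (s : ZMod N)), ?_,
          ?_, tFaceConnected_segment x μ k, Finset.card_image_le.trans (by simp)⟩
        · have := update_mem_segment x μ (Nat.zero_le k)
          rwa [Nat.cast_zero, add_zero, Function.update_eq_self] at this
        · have hx'' : x' = Function.update x μ (x μ + (k : ZMod N)) := by rw [hx', h]
          rw [hx'']
          exact update_mem_segment x μ le_rfl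
    obtain ⟨T, hxT, hx'T, hcT, hcardT⟩ := hseg
    refine ⟨T ∪ X', Finset.mem_union_left _ hxT, Finset.mem_union_right _ hyX,
      tFaceConnected_union hcT hcX ⟨x', Finset.mem_inter.2 ⟨hx'T, hx'X⟩⟩, ?_⟩
    have hinter : 1 ≤ (T ∩ X').card := Finset.card_pos.2 ⟨x', Finset.mem_inter.2 ⟨hx'T, hx'X⟩⟩
    have hunion : ((T ∪ X').card : ℤ) + (T ∩ X').card = T.card + X'.card := by
      exact_mod_cast Finset.card_union_add_card_inter T X'
    rw [Finset.sum_insert hμ, ← hk]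
    linarith

/-- **Connecting polymer, counted.**  Any two cubes `x, y` of `(ℤ∕N)^d` lie in a torus-face-connected family `X` with
`|X| − 1 ≤ Σ_μ dist(x_μ − y_μ, Nℤ) ≤ d · tdistT x y` (`tdistT` = the sup-circular distance of `King1986.Torus`, each circular
coordinate distance `≤ tdistT`: `circAbs_le_tdistT`). [cite: Balaban1987RG1, p.257 (connected families of cubes)] -/
theorem exists_connecting_polymer (x y : TPt d N) :
    ∃ X : Finset (TPt d N), x ∈ X ∧ y ∈ X ∧ TFaceConnected X ∧
      (X.card : ℝ) - 1 ≤ d * tdistT (fun _ : Fin d => N) x y := by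
  obtain ⟨X, hx, hy, hc, hcard⟩ :=
    exists_torusStaircase (N := N) Finset.univ x y (fun μ h => absurd (Finset.mem_univ μ) h)
  refine ⟨X, hx, hy, hc, ?_⟩
  have hsum : ((∑ μ : Fin d, circAbs N (((x μ).val : ℤ) - ((y μ).val : ℤ)) : ℤ) : ℝ)
      ≤ d * tdistT (fun _ : Fin d => N) x y := by
    push_cast
    calc ∑ μ : Fin d, (circAbs N (((x μ).val : ℤ) - ((y μ).val : ℤ)) : ℝ)
        ≤ ∑ _μ : Fin d, tdistT (fun _ : Fin d => N) x y :=
          Finset.sum_le_sum fun μ _ => circAbs_le_tdistT (fun _ : Fin d => N) x y μ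
      _ = d * tdistT (fun _ : Fin d => N) x y := by simp
  have hcard' : ((X.card : ℤ) : ℝ) - 1 ≤ ((∑ μ : Fin d, circAbs N (((x μ).val : ℤ) - ((y μ).val : ℤ)) : ℤ) : ℝ) := by
    exact_mod_cast hcard
  push_cast at hcard' hsum
  linarith

/-- **CONNECTING LOCALIZATION DOMAIN.**  Any two cubes `x, y` of the torus `π_j ≅ (ℤ∕N)^d` lie in a localization domain
`X ∈ 𝐃_j` (non-empty, torus-face-connected) of linear size `d_j(X) ≤ d · |x − y|_{T₁}` — the staircase of
`exists_connecting_polymer` and the upper half of (2.30), `d_j(X) ≤ |X| − 1` (`TreeLengthTorus.torusTreeLen_le_card_sub_one`).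
This is the geometry by which a two-point kernel with decay in the torus distance becomes a polymer activity with decay in
the tree length. [cite: Balaban1988RG2Cluster, (2.30) p.18 (upper half); Balaban1987RG1, p.257 (linear size d_j)] -/
theorem exists_connecting_tdom (x y : TPt d N) :
    ∃ X : TDom d N, x ∈ X.1 ∧ y ∈ X.1 ∧ torusTreeLen X.1 ≤ d * tdistT (fun _ : Fin d => N) x y := by
  obtain ⟨X, hx, hy, hc, hcard⟩ := exists_connecting_polymer x y
  exact ⟨⟨X, ⟨x, hx⟩, hc⟩, hx, hy, (torusTreeLen_le_card_sub_one ⟨x, hx⟩ hc).trans hcard⟩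

end Geometry

/-! ## §2 The transfer with its decay: King's three-factor graphs on the END's carriers through live domains -/

section EndCarriers

variable {d : ℕ} {L' : ℕ} [NeZero L']

open Classical in
/-- **KING'S MODEL ON THE END'S CARRIERS, WITH ITS DECAY** (the `κ` half of «(κ, C₅) → `TwoRunTorusNE5Final*`»).
For `d ≥ 1`, odd `L > 1`, `a > 0`, `m² > 0`, `0 ≤ γ ≤ 1` there are `κ > 0`, `C₅ ≥ 0` — functions of `d, L, a, m², γ` ONLY, the
letters of `N18KingModelTorus.ne5_kingModel_threeFactor_torus` — such that: for every `n ≥ 1`; every scale-indexed family of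
unit tori `L·M_k(μ) = 2L^{m_k}`; every END data (`N j` cubes per direction at scale `j`, torus steps `W j`); every set `S` of
LIVE domains and ratio `ρ ≥ 0`; every reading, by the END's domains `⟨j, X⟩`, of run-A fine points `x_A, y_A` on King's
level `j + 1` (`L^{j+1}` points per unit side) UNDER run B's `x_B, y_B` (`L^nL^{j+1}` points), LOCATED on `S`:
`ρ·d_j(X) ≤ |B(x_A X) − B(y_A X)|_{T₁}`; every two real families `K_A, K_B` on `Σ_j 𝐃_j` which ON `S` are King's ACTUAL (4.42)
three-factor graphs `Σ_{z,w} ℋ_{j+1}(x_A, z)·C^{(j+1)}(z, w)·ℋ_{j+1}(y_A, w)` ∕ `Σ_{z,w} ℋ_{j+1+n}(x_B, z)·C^{(j+1+n)}(z, w)·ℋ_{j+1+n}(y_B, w)`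
(`ℋ = minimiser`, `C^{(·)} = (effLaplacian + aL⁻²·blockProj)⁻¹`) and OFF `S` agree; every window `W′`:
`NE5 (torusCarriers N W) (reFunctional N W K_A) (reFunctional N W K_B) W′ (κ·ρ) (L^{−γ∕2}) C₅` — King's `e^{−κ·|B(x_A) − B(y_A)|}`
dominates `e^{−κρ·d_j(X)}` on live domains, dead domains contribute `0`.  A = 0 MODEL; one pair per live domain.
[cite: King1986, Prop. 3.9 (3.73) p.665, (4.42)–(4.43) p.675; Balaban1987RG1, (0.24)-(0.25) p.257, Thm 1 p.259; Balaban1985UV3, p.262] -/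
theorem ne5_kingModel_endCarriers_decay (hd : 1 ≤ d) (L : ℕ) [NeZero L] (hLp : Odd L ∧ 1 < L) {a m2 : ℝ}
    (ha : 0 < a) (hm : 0 < m2) {γ : ℝ} (hγ0 : 0 ≤ γ) (hγ1 : γ ≤ 1) :
    ∃ κ C₅ : ℝ, 0 < κ ∧ 0 ≤ C₅ ∧
      ∀ (n : ℕ) (_hn : 1 ≤ n) (M : ℕ → Fin d → ℕ) [∀ k μ, NeZero (M k μ)]
        (_hM : ∀ k, ∃ mm : ℕ, ∀ μ, L * M k μ = 2 * L ^ mm)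
        (N : ℕ → ℕ) [∀ j, NeZero (N j)] (W : (j : ℕ) → TwoTorusStep 4 L' (N j))
        (S : Set (Σ j : ℕ, TDom 4 (N j))) (ρ : ℝ) (_hρ : 0 ≤ ρ)
        (xA yA : (X : Σ j : ℕ, TDom 4 (N j)) → Tor (fine (L ^ (X.1 + 1)) (fine L (M (X.1 + 1)))))
        (xB yB : (X : Σ j : ℕ, TDom 4 (N j)) → Tor (fine (L ^ n * L ^ (X.1 + 1)) (fine L (M (X.1 + 1)))))
        (_hx : ∀ X μ, (xA X μ).val = (xB X μ).val / L ^ n)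
        (_hy : ∀ X μ, (yA X μ).val = (yB X μ).val / L ^ n)
        (_hloc : ∀ X ∈ S, ρ * torusTreeLen X.2.1 ≤ tdistT (fine L (M (X.1 + 1)))
            (blockOf (L ^ (X.1 + 1)) (fine L (M (X.1 + 1))) (xA X))
            (blockOf (L ^ (X.1 + 1)) (fine L (M (X.1 + 1))) (yA X)))
        (KA KB : (Σ j : ℕ, TDom 4 (N j)) → ℝ)
        (_hKA : ∀ X ∈ S, KA X =
          (fun z => minimiser (L ^ (X.1 + 1)) (fine L (M (X.1 + 1))) (aK a L (X.1 + 1))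
              (((L ^ (X.1 + 1) : ℕ) : ℝ) ^ 2) m2 (Pi.single z 1) (xA X))
            ⬝ᵥ ((effLaplacian (L ^ (X.1 + 1)) (fine L (M (X.1 + 1))) (aK a L (X.1 + 1))
                    (((L ^ (X.1 + 1) : ℕ) : ℝ) ^ 2) m2
                  + (a * ((L : ℝ) ^ 2)⁻¹) • blockProj L (M (X.1 + 1)))⁻¹
                *ᵥ fun w => minimiser (L ^ (X.1 + 1)) (fine L (M (X.1 + 1))) (aK a L (X.1 + 1))
                    (((L ^ (X.1 + 1) : ℕ) : ℝ) ^ 2) m2 (Pi.single w 1) (yA X)))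
        (_hKB : ∀ X ∈ S, KB X =
          (fun z => minimiser (L ^ n * L ^ (X.1 + 1)) (fine L (M (X.1 + 1))) (aK a L (X.1 + 1 + n))
              (((L ^ n * L ^ (X.1 + 1) : ℕ) : ℝ) ^ 2) m2 (Pi.single z 1) (xB X))
            ⬝ᵥ ((effLaplacian (L ^ n * L ^ (X.1 + 1)) (fine L (M (X.1 + 1))) (aK a L (X.1 + 1 + n))
                    (((L ^ n * L ^ (X.1 + 1) : ℕ) : ℝ) ^ 2) m2
                  + (a * ((L : ℝ) ^ 2)⁻¹) • blockProj L (M (X.1 + 1)))⁻¹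
                *ᵥ fun w => minimiser (L ^ n * L ^ (X.1 + 1)) (fine L (M (X.1 + 1))) (aK a L (X.1 + 1 + n))
                    (((L ^ n * L ^ (X.1 + 1) : ℕ) : ℝ) ^ 2) m2 (Pi.single w 1) (yB X)))
        (_hdead : ∀ X ∉ S, KA X = KB X)
        (W' : Set (ℕ → ℝ)),
        NE5 (C := torusCarriers N W) (reFunctional N W fun j X _ => ((KA ⟨j, X⟩ : ℝ) : ℂ))
          (reFunctional N W fun j X _ => ((KB ⟨j, X⟩ : ℝ) : ℂ)) W' (κ * ρ) ((L : ℝ) ^ (-(γ / 2))) C₅ := by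
  obtain ⟨κ, C₅, hκ, hC₅, H⟩ := ne5_kingModel_threeFactor_torus hd L hLp ha hm hγ0 hγ1
  refine ⟨κ, C₅, hκ, hC₅, ?_⟩
  intro n hn M _ hM N _ W S ρ hρ xA yA xB yB hx hy hloc KA KB hKA hKB hdead W'
  set θ : ℝ := (L : ℝ) ^ (-(γ / 2)) with hθ_def
  have hL1 : 1 ≤ L := by have := hLp.2; omega
  have hθ0 : 0 ≤ θ := (kingTheta_pos hL1 (γ / 2)).le
  have hθ1 : θ ≤ 1 := kingTheta_le_one hL1 (by linarith)
  -- the auxiliary carriers: the END's domains with King's level `j + 1` and the tree length `min(ρ·d_j(X), block distance)`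
  let C' : Carriers :=
    { Dom := Σ j : ℕ, TDom 4 (N j), scale := fun X => X.1 + 1,
      d := fun X => min (ρ * torusTreeLen X.2.1) (tdistT (fine L (M (X.1 + 1)))
        (blockOf (L ^ (X.1 + 1)) (fine L (M (X.1 + 1))) (xA X))
        (blockOf (L ^ (X.1 + 1)) (fine L (M (X.1 + 1))) (yA X))),
      d_nonneg := fun X => le_min (mul_nonneg hρ (torusTreeLen_nonneg _)) (tdistT_nonneg _ _ _),
      BgA := PUnit, BgB := PUnit, gauge := fun _ _ => 0, gauge_nonneg := fun _ _ => le_rfl, transport := id }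
  -- King's (3.73) first bound for the ACTUAL (4.42) three-factor graphs on `C'` (p418046), every binder a read-out formula
  have h5 := H n hn M hM C' (fun _ => Nat.succ_le_succ (Nat.zero_le _)) xA yA xB yB hx hy
    (fun X => min_le_right _ _)
    (fun _ _ X => (fun z => minimiser (L ^ (X.1 + 1)) (fine L (M (X.1 + 1))) (aK a L (X.1 + 1))
        (((L ^ (X.1 + 1) : ℕ) : ℝ) ^ 2) m2 (Pi.single z 1) (xA X))
      ⬝ᵥ ((effLaplacian (L ^ (X.1 + 1)) (fine L (M (X.1 + 1))) (aK a L (X.1 + 1))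
              (((L ^ (X.1 + 1) : ℕ) : ℝ) ^ 2) m2
            + (a * ((L : ℝ) ^ 2)⁻¹) • blockProj L (M (X.1 + 1)))⁻¹
          *ᵥ fun w => minimiser (L ^ (X.1 + 1)) (fine L (M (X.1 + 1))) (aK a L (X.1 + 1))
              (((L ^ (X.1 + 1) : ℕ) : ℝ) ^ 2) m2 (Pi.single w 1) (yA X)))
    (fun _ _ X => (fun z => minimiser (L ^ n * L ^ (X.1 + 1)) (fine L (M (X.1 + 1))) (aK a L (X.1 + 1 + n))
        (((L ^ n * L ^ (X.1 + 1) : ℕ) : ℝ) ^ 2) m2 (Pi.single z 1) (xB X))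
      ⬝ᵥ ((effLaplacian (L ^ n * L ^ (X.1 + 1)) (fine L (M (X.1 + 1))) (aK a L (X.1 + 1 + n))
              (((L ^ n * L ^ (X.1 + 1) : ℕ) : ℝ) ^ 2) m2
            + (a * ((L : ℝ) ^ 2)⁻¹) • blockProj L (M (X.1 + 1)))⁻¹
          *ᵥ fun w => minimiser (L ^ n * L ^ (X.1 + 1)) (fine L (M (X.1 + 1))) (aK a L (X.1 + 1 + n))
              (((L ^ n * L ^ (X.1 + 1) : ℕ) : ℝ) ^ 2) m2 (Pi.single w 1) (yB X)))
    (fun _ _ _ => rfl) (fun _ _ _ => rfl) Set.univ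
  refine ne5_reFunctional_of_real N W KA KB hC₅ hθ0 (fun X => ?_) W'
  by_cases hXS : X ∈ S
  · -- a LIVE domain: King's bound at level `j + 1`, `θ^{j+1} ≤ θ^j`, and `min = ρ·d_j(X)` by the located binder
    have hX := h5 (fun _ => 1) (Set.mem_univ _) PUnit.unit X
    beta_reduce at hX
    rw [← hKA X hXS, ← hKB X hXS] at hX
    have hsc : C'.scale X = X.1 + 1 := rfl
    have hdX : C'.d X = ρ * torusTreeLen X.2.1 := min_eq_left (hloc X hXS)
    rw [hsc, hdX] at hX
    refine hX.trans ?_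
    rw [TreeLengthTorus.tsys_dj, show κ * ρ * torusTreeLen X.2.1 = κ * (ρ * torusTreeLen X.2.1) by ring]
    refine mul_le_mul_of_nonneg_right (mul_le_mul_of_nonneg_left ?_ hC₅) (Real.exp_pos _).le
    calc θ ^ (X.1 + 1) = θ ^ X.1 * θ := pow_succ θ X.1
      _ ≤ θ ^ X.1 * 1 := mul_le_mul_of_nonneg_left hθ1 (pow_nonneg hθ0 _)
      _ = θ ^ X.1 := mul_one _
  · -- a DEAD domain: both runs read the same value
    rw [hdead X hXS, sub_self, abs_zero]
    positivity

/-- The letters of §2 have CONTENT: for a live ratio `ρ > 0` the END's decay exponent `κρ` is positive, and for `γ > 0`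
the rate `L^{−γ∕2}` lies in `]0, 1[` (`N18KingModelTorus.ne5_kingModel_threeFactor_letters`). [cite: King1986, Prop. 3.9 (3.73) p.665] -/
theorem endCarriers_decay_letters {κ ρ : ℝ} (hκ : 0 < κ) (hρ : 0 < ρ) {L : ℕ} (hL : 2 ≤ L) {γ : ℝ} (hγ : 0 < γ) :
    0 < κ * ρ ∧ 0 < (L : ℝ) ^ (-(γ / 2)) ∧ (L : ℝ) ^ (-(γ / 2)) < 1 :=
  ⟨mul_pos hκ hρ, ne5_kingModel_threeFactor_letters hL hγ⟩

end EndCarriers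

/-! ## §3 Non-vacuity: every pair of blocks lies in a live domain (d = 4, ρ = 1∕4) -/

section Inhabited

/-- **EVERY PAIR OF BLOCKS IS CARRIED BY A LIVE DOMAIN** (`ρ = 1∕4`).  On King's unit torus `T₁ = Π_{μ<4} ℤ∕(L·M_μ)` of a
Bałaban volume — which IS the END's torus of unit cubes `(ℤ∕(L·M))^4` when `M_μ = M` (`TPt 4 (L·M) = Tor (fine L M)`
definitionally) — every two blocks `p, q` lie in a localization domain `X ∈ 𝐃_j` with `(1∕4)·d_j(X) ≤ |p − q|_{T₁}`: the
located binder of `ne5_kingModel_endCarriers_decay` is met at EVERY pair (`exists_connecting_tdom` with `d = 4`).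
[cite: Balaban1987RG1, p.257 (linear size d_j); Balaban1988RG2Cluster, (2.30) p.18 (upper half)] -/
theorem exists_live_domain (L M : ℕ) [NeZero L] [NeZero M] (p q : Tor (fine L (fun _ : Fin 4 => M))) :
    ∃ X : TDom 4 (L * M), p ∈ X.1 ∧ q ∈ X.1 ∧
      (1 / 4 : ℝ) * torusTreeLen X.1 ≤ tdistT (fine L (fun _ : Fin 4 => M)) p q := by
  obtain ⟨X, hp, hq, hX⟩ := exists_connecting_tdom (d := 4) (N := L * M) p q
  refine ⟨X, hp, hq, ?_⟩
  have h4 : torusTreeLen X.1 ≤ 4 * tdistT (fine L (fun _ : Fin 4 => M)) p q := by exact_mod_cast hX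
  linarith

end Inhabited

end Summit.QuantumFields.YangMills.BalabanUVNodes.N18KingModelEndDecay

end
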